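import Literature.NumberTheory.Automorphic.Liu2021.Sec13ArithmeticFundamentalLemma
import HarnessLib

/-!
# Liu 2021, §1.3 — discharge of the definitional named fact of ★ `Sec13ArithmeticFundamentalLemma`

Proof file (theorems only: no definition, no named fact, no instance, no `sorry`), sibling of the statement-only carpet
★ `Literature/NumberTheory/Automorphic/Liu2021/Sec13ArithmeticFundamentalLemma.lean` [Liu2021, §1.3, print pp. 13–15].  Since that
carpet's ED.3 (squad TL RETRO-AUDIT, ruling g2-3 (3), option (ii′)) the four printed properties of the specific lattice `Λ_n :=
Hom_k((𝕏_{0k}, i_{0k}), (𝕏_n, i_n))` and space `V_n^- := (Λ_n)_ℚ` — «`V_n^-` is an `E`-vectors space of rank `n`» (so `Λ_n` is a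
finitely generated `O_E`-lattice spanning it), «we have `Λ_n ⊆ Λ_n^*`», «the determinant of `V_n^-` has odd valuation» (p. 14 L5–13) —
are HYPOTHESIS FIELDS of the ⟨CARRIER⟩ dictionary `RZDictionary` (`lambda_fg`, `lambda_span_eq_top`, `lambda_le_dual`,
`vminus_parity`), and the carpet's ED.1 named fact `RZDictionary.LatticeFactsAsPrinted` (statement unchanged) is exactly their
conjunction.  It is discharged here, for every dictionary, by projecting the fields:

* `RZDictionary.LatticeFactsAsPrinted_holds : R.LatticeFactsAsPrinted` (same parameters `S`, `n`, `R` as the def, via `variable`).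

Nothing printed is PROVED by this (the content is carried by the dictionary as data, as the carpet's READING Z2 explains); the
theorem only retires the ED.1 pseudo-fact from the census honestly (−1 by discharge, nothing deleted).

## References
* [Liu2021] Y. Liu, *Fourier–Jacobi cycles and arithmetic relative trace formula*, Camb. J. Math. 9 (2021) 1–147, §1.3, p. 14 L5–13
  (the lattice `Λ_n`, its dual, the odd valuation of `det V_n^-`).
-/

noncomputable section

namespace Literature.NumberTheory.Automorphic.Liu2021.Sec13ArithmeticFundamentalLemma

open Literature.NumberTheory.Automorphic.Liu2021.Sec13RelativeFundamentalLemma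

variable {F E : Type} [Field F] [ValuativeRel F] [TopologicalSpace F] [IsNonarchimedeanLocalField F]
  [Field E] [ValuativeRel E] [TopologicalSpace E] [IsNonarchimedeanLocalField E] [Algebra F E]
  {S : AFLSetup F E} {n : ℕ}

namespace RZDictionary

variable (R : RZDictionary S n)

/-- **The printed lattice facts hold for every dictionary** ([Liu2021, §1.3, p. 14 L5–13]: «`V_n^- := (Λ_n)_ℚ` … an `E`-vectors
space of rank `n`», «we have `Λ_n ⊆ Λ_n^*`», «the determinant of `V_n^-` has odd valuation»): discharge of the carpet's named fact
★ `RZDictionary.LatticeFactsAsPrinted` from the hypothesis fields `lambda_fg`, `lambda_span_eq_top`, `lambda_le_dual`,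
`vminus_parity` of `RZDictionary` (carpet ED.3, READING Z2). [cite: Liu2021, §1.3 (p. 14)] -/
theorem LatticeFactsAsPrinted_holds : R.LatticeFactsAsPrinted :=
  ⟨R.lambda_fg, R.lambda_span_eq_top, R.lambda_le_dual, R.vminus_parity⟩

end RZDictionary

end Literature.NumberTheory.Automorphic.Liu2021.Sec13ArithmeticFundamentalLemma

end
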